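import Mathlib.Analysis.SpecialFunctions.Pow.Real
import HarnessLib

/-!
# K2R `RealisedQuasiStaticCellLaw`, line `floquet-bloch`, stub `stub_lowSectorDecay` (S1D): the per-slot contraction factor
# of the weak-coupling roads absorbs its slack (pure real arithmetic)

Summits-side helper file (everything proved; no definitions, no named facts; `--supports stmt-AnomalousDissipation-20446`).
The slot factors of `weakSector_decay_ae` / `pairSector_slot_contraction` have the form
`θ = exp(−2Λτ(d₀ + (1−ε)σg₁²(1−4ρ/3)) + 40βγ²Λτg₁⁴(1+g₁²σ'²)/Δ³ + 48βγ²g₁²/(ρτΛΔ³))`. If `γ² ≤ 2σ`, `σ' ≤ σ_max`,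
`80βg₁²(1+g₁²σ_max²) ≤ εΔ³(1−4ρ/3)` and `96β ≤ ερΔ³(1−4ρ/3)(Λτ)²`, the slack is at most `ε` times the coupling term:
`θ ≤ exp(−2Λτ(d₀ + (1−2ε)σg₁²(1−4ρ/3))) ≤ 1` (`weak_slot_factor_le`). This is the «Θ_j ≤ 1 and rate» step of the arithmetic.
-/

set_option linter.dupNamespace false

noncomputable section

namespace Summit.AnomalousDissipation.AnomalousDissipation.Theorems.SolenoidalFractalHomogenisation.RealisedQuasiStaticCellLaw

/-- **The weak slot factor absorbs its slack.** -/
theorem weak_slot_factor_le {Λ τ d0 ε σ σ' σmax g₁ γ2 β ρ Δ : ℝ} (hΛ : 0 < Λ) (hτ : 0 < τ) (hd0 : 0 ≤ d0)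
    (hσ : 0 ≤ σ) (hσ' : 0 ≤ σ') (hσ'max : σ' ≤ σmax) (hγσ : γ2 ≤ 2 * σ) (hβ : 0 ≤ β)
    (hρ : 0 < ρ) (hρ2 : ρ ≤ 1 / 2) (hΔ : 0 < Δ)
    (hS1 : 80 * β * g₁ ^ 2 * (1 + g₁ ^ 2 * σmax ^ 2) ≤ ε * Δ ^ 3 * (1 - 4 * ρ / 3))
    (hS2 : 96 * β ≤ ε * ρ * Δ ^ 3 * (1 - 4 * ρ / 3) * (Λ * τ) ^ 2) :
    Real.exp (-(2 * Λ * τ * (d0 + (1 - ε) * σ * (g₁ ^ 2 * (1 - 4 * ρ / 3)))) +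
          40 * β * γ2 * Λ * τ * g₁ ^ 4 * (1 + g₁ ^ 2 * σ' ^ 2) / Δ ^ 3 + 48 * β * γ2 * g₁ ^ 2 / (ρ * τ * Λ * Δ ^ 3)) ≤
        Real.exp (-(2 * Λ * τ * (d0 + (1 - 2 * ε) * σ * (g₁ ^ 2 * (1 - 4 * ρ / 3))))) ∧
      (ε ≤ 1 / 2 → Real.exp (-(2 * Λ * τ * (d0 + (1 - 2 * ε) * σ * (g₁ ^ 2 * (1 - 4 * ρ / 3))))) ≤ 1) := by
  have hT : 0 < Λ * τ := mul_pos hΛ hτ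
  have hr : 0 ≤ 1 - 4 * ρ / 3 := by linarith
  have hg : 0 ≤ g₁ ^ 2 := sq_nonneg _
  obtain ⟨A, hA⟩ : ∃ A : ℝ, A = Λ * τ * σ * (g₁ ^ 2 * (1 - 4 * ρ / 3)) := ⟨_, rfl⟩
  have hA0 : 0 ≤ A := by rw [hA]; exact mul_nonneg (mul_nonneg hT.le hσ) (mul_nonneg hg hr)
  -- first slack term ≤ ε·A
  have h1 : 40 * β * γ2 * Λ * τ * g₁ ^ 4 * (1 + g₁ ^ 2 * σ' ^ 2) / Δ ^ 3 ≤ ε * A := by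
    have hΔ3 : 0 < Δ ^ 3 := by positivity
    rw [div_le_iff₀ hΔ3, hA]
    have hσ'2 : σ' ^ 2 ≤ σmax ^ 2 := pow_le_pow_left₀ hσ' hσ'max 2
    have hin : 1 + g₁ ^ 2 * σ' ^ 2 ≤ 1 + g₁ ^ 2 * σmax ^ 2 := by nlinarith [hg]
    have hin0 : 0 ≤ 1 + g₁ ^ 2 * σ' ^ 2 := by positivity
    -- 40βγ2ΛτG²(1+Gσ'²) ≤ 40β(2σ)ΛτG²(1+Gσmax²) = σΛτG·[80βG(1+Gσmax²)] ≤ σΛτG·εΔ³(1−4ρ/3)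
    have s1 : 40 * β * γ2 * Λ * τ * g₁ ^ 4 * (1 + g₁ ^ 2 * σ' ^ 2) ≤
        40 * β * (2 * σ) * Λ * τ * g₁ ^ 4 * (1 + g₁ ^ 2 * σmax ^ 2) := by
      have a1 : 40 * β * γ2 * Λ * τ * g₁ ^ 4 * (1 + g₁ ^ 2 * σ' ^ 2) ≤
          40 * β * (2 * σ) * Λ * τ * g₁ ^ 4 * (1 + g₁ ^ 2 * σ' ^ 2) := by
        have : 0 ≤ 40 * β * Λ * τ * g₁ ^ 4 * (1 + g₁ ^ 2 * σ' ^ 2) := by positivity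
        nlinarith [this, hγσ]
      have a2 : 40 * β * (2 * σ) * Λ * τ * g₁ ^ 4 * (1 + g₁ ^ 2 * σ' ^ 2) ≤
          40 * β * (2 * σ) * Λ * τ * g₁ ^ 4 * (1 + g₁ ^ 2 * σmax ^ 2) := by
        have : 0 ≤ 40 * β * (2 * σ) * Λ * τ * g₁ ^ 4 := by positivity
        exact mul_le_mul_of_nonneg_left hin this
      linarith
    have s2 : 40 * β * (2 * σ) * Λ * τ * g₁ ^ 4 * (1 + g₁ ^ 2 * σmax ^ 2) =
        (σ * (Λ * τ) * g₁ ^ 2) * (80 * β * g₁ ^ 2 * (1 + g₁ ^ 2 * σmax ^ 2)) := by ring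
    have s3 := mul_le_mul_of_nonneg_left hS1 (by positivity : 0 ≤ σ * (Λ * τ) * g₁ ^ 2)
    have e3 : σ * (Λ * τ) * g₁ ^ 2 * (ε * Δ ^ 3 * (1 - 4 * ρ / 3)) =
        ε * (Λ * τ * σ * (g₁ ^ 2 * (1 - 4 * ρ / 3))) * Δ ^ 3 := by ring
    linarith [s1, s2, s3, e3]
  -- second slack term ≤ ε·A
  have h2 : 48 * β * γ2 * g₁ ^ 2 / (ρ * τ * Λ * Δ ^ 3) ≤ ε * A := by
    have hden : 0 < ρ * τ * Λ * Δ ^ 3 := by positivity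
    rw [div_le_iff₀ hden, hA]
    have s1 : 48 * β * γ2 * g₁ ^ 2 ≤ 48 * β * (2 * σ) * g₁ ^ 2 := by
      have : 0 ≤ 48 * β * g₁ ^ 2 := by positivity
      nlinarith [this, hγσ]
    have s2 : 48 * β * (2 * σ) * g₁ ^ 2 = (σ * g₁ ^ 2) * (96 * β) := by ring
    have s3 := mul_le_mul_of_nonneg_left hS2 (by positivity : 0 ≤ σ * g₁ ^ 2)
    have e3 : σ * g₁ ^ 2 * (ε * ρ * Δ ^ 3 * (1 - 4 * ρ / 3) * (Λ * τ) ^ 2) =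
        ε * (Λ * τ * σ * (g₁ ^ 2 * (1 - 4 * ρ / 3))) * (ρ * τ * Λ * Δ ^ 3) := by ring
    linarith [s1, s2, s3, e3]
  refine ⟨?_, fun hε2 => ?_⟩
  · refine Real.exp_le_exp.2 ?_
    have e1 : -(2 * Λ * τ * (d0 + (1 - ε) * σ * (g₁ ^ 2 * (1 - 4 * ρ / 3)))) = -(2 * Λ * τ * d0) - 2 * (1 - ε) * A := by
      rw [hA]; ring
    have e2 : -(2 * Λ * τ * (d0 + (1 - 2 * ε) * σ * (g₁ ^ 2 * (1 - 4 * ρ / 3)))) = -(2 * Λ * τ * d0) - 2 * (1 - 2 * ε) * A := by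
      rw [hA]; ring
    rw [e1, e2]
    linarith [h1, h2]
  · refine Real.exp_le_one_iff.2 ?_
    have : 0 ≤ 2 * Λ * τ * (d0 + (1 - 2 * ε) * σ * (g₁ ^ 2 * (1 - 4 * ρ / 3))) := by
      have h12 : 0 ≤ 1 - 2 * ε := by linarith
      have : 0 ≤ (1 - 2 * ε) * σ * (g₁ ^ 2 * (1 - 4 * ρ / 3)) := mul_nonneg (mul_nonneg h12 hσ) (mul_nonneg hg hr)
      positivity
    linarith

end Summit.AnomalousDissipation.AnomalousDissipation.Theorems.SolenoidalFractalHomogenisation.RealisedQuasiStaticCellLaw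

end
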